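import Summits.CriticalPhenomena.SAWScalingLimit.Theses.SAWLoopFugacityFlow
import Literature.Probability.RandomPlanarGeometry.SupercriticalSAWPolygons

/-!
# Crux AvoidanceLimit (stmt-CriticalPhenomena-10649) — ideator 1, round 1: first lemmas of three levers

Scratch file of planner-cruxidea-stmt-CriticalPhenomena-10649-1-0. Nothing here is an item;
the three `First lemma` signatures of the idea cards

* `pinch-bootstrap-five-eighths`   — `avoidanceLimit_of_pinchBootstrap`, `fusionExponent_eq_two_iff`
* `symplectic-fermion-anchor`      — `LERWBoundaryRatio`, `adjugate_pathExpansion`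
* `saw-corner-germ`                — `CornerGerm`

elaborate against the route file (crux decl `…SAWLoopFugacityFlow.AvoidanceLimit`).
-/

noncomputable section

namespace Summit.CriticalPhenomena.SAWScalingLimit.Cruxes.AvoidanceLimit.Ideator1

open scoped BigOperators Topology ENNReal
open Filter Set MeasureTheory
open Literature.Probability.RandomPlanarGeometry Literature.Probability.LatticeModels
open Summit.CriticalPhenomena.SAWScalingLimit.Theses.SAWLoopFugacityFlow (AvoidanceLimit)

/-! ## Lever 1: pinch bootstrap -/

/-- The crux with the exponent `5/8` replaced by a parameter `α` ("value-free covariance with SOME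
exponent"; `α = 5/8` is literally `AvoidanceLimit`, see `avoidanceLimit_iff_with`). -/
def AvoidanceLimitWith (α : ℝ) : Prop :=
  ∀ (D D' : DobrushinDomain) (a b : ℝ → Site 2), SAW.IsEndpointApprox D a b →
    D'.carrier ⊆ D.carrier → D'.pt 0 = D.pt 0 → D'.pt 1 = D.pt 1 →
    (∃ ε : ℝ, 0 < ε ∧ D'.carrier ∩ Metric.ball (D.pt 0) ε = D.carrier ∩ Metric.ball (D.pt 0) ε ∧
      D'.carrier ∩ Metric.ball (D.pt 1) ε = D.carrier ∩ Metric.ball (D.pt 1) ε) →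
    ∀ (φ : ConformalEquiv UpperHalfPlane.upperHalfPlaneSet D.carrier), D.IsChordalUniformizing φ →
    ∀ (A : Set ℂ), A = closure (UpperHalfPlane.upperHalfPlaneSet \
      {z | z ∈ UpperHalfPlane.upperHalfPlaneSet ∧ φ z ∈ D'.carrier}) →
    ∀ (Φ : ConformalEquiv (UpperHalfPlane.upperHalfPlaneSet \ A) UpperHalfPlane.upperHalfPlaneSet)
      (d : ℝ), IsRestrictionMap A Φ → HasRestrictionDeriv A Φ d →
    Tendsto (fun δ => ((SAW.law D.carrier δ (a δ) (b δ)).map (fun γ => γ.curve))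
      (CurveClass.rangeSubset (closure D'.carrier))) (𝓝[>] 0) (𝓝 (ENNReal.ofReal (d ^ α)))

/-- `AvoidanceLimit` is the `α = 5/8` instance, definitionally. -/
theorem avoidanceLimit_iff_with : AvoidanceLimit ↔ AvoidanceLimitWith ((5 : ℝ) / 8) := Iff.rfl

/-- The pinch charge `U(α) = √(24α+1) − 1` (additive under mutual avoidance of restriction samples:
`U(ξ̃(α₁,…,α_k)) = U(α₁) + ⋯ + U(α_k)`, Lawler 2005 (8.12)–(8.14); `U(5/8) = 3`, `U(1) = 4`). -/
def pinchCharge (α : ℝ) : ℝ := Real.sqrt (24 * α + 1) - 1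

/-- The boundary FUSION (two-leg pinch) exponent of an `α`-restriction family with the renewal
property: `ξ̃(α, α) = U(U+1)/6` with `U = U(α)` (two legs, `U_total = 2U`). -/
def fusionExponent (α : ℝ) : ℝ := pinchCharge α * (pinchCharge α + 1) / 6

/-- `ξ̃(5/8, 5/8) = 2` ("two SLE_{8/3} conditioned not to intersect = P₂", LSW03 §10). -/
theorem fusionExponent_five_eighths : fusionExponent (5 / 8) = 2 := by
  unfold fusionExponent pinchCharge
  have h : Real.sqrt (24 * (5 / 8 : ℝ) + 1) = 4 := by
    rw [show (24 * (5 / 8 : ℝ) + 1) = 4 ^ 2 by norm_num]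
    exact Real.sqrt_sq (by norm_num)
  rw [h]; norm_num

/-- **The bootstrap equation has the unique root `5/8`.** `ξ̃(α, α) = 2 ↔ α = 5/8` on `α ≥ 0`
(the extraneous root `1/3` of the squared equation has `√(24α+1) = 3 ≠ 24α − 11`). -/
theorem fusionExponent_eq_two_iff {α : ℝ} (hα : 0 ≤ α) : fusionExponent α = 2 ↔ α = 5 / 8 := by
  constructor
  · intro h
    unfold fusionExponent pinchCharge at h
    set s := Real.sqrt (24 * α + 1) with hs
    have hs0 : 0 ≤ s := Real.sqrt_nonneg _
    have hsq : s ^ 2 = 24 * α + 1 := by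
      rw [hs]; exact Real.sq_sqrt (by linarith)
    -- (s - 1) * s / 6 = 2  ⇒  s² - s - 12 = 0  ⇒  (s - 4)(s + 3) = 0  ⇒  s = 4
    have h1 : (s - 4) * (s + 3) = 0 := by nlinarith [h]
    have h2 : s = 4 := by
      rcases mul_eq_zero.1 h1 with h4 | h3
      · linarith
      · linarith
    nlinarith [hsq, h2]
  · rintro rfl
    exact fusionExponent_five_eighths

/-- **First lemma of the pinch-bootstrap line.** If the critical SAW avoidance ratios converge to
`Φ'_A(0)^α` for SOME `α ≥ 0` (value-free covariance, from any source: the route's analytic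
continuation with an unidentified exponent `b(0)`, or AvoidanceCocycleLimit + rigidity) and the
SAW's boundary fusion exponent — forced to be `2` by Hadamard's small-hull expansion
`Φ'_{B(x,ε)}(0) = 1 − ε²/x²` — equals `ξ̃(α, α)` (exact cut-vertex renewal at a boundary pinch +
LSW non-intersection additivity), then `α = 5/8`, i.e. the crux holds. -/
theorem avoidanceLimit_of_pinchBootstrap
    (h : ∃ α : ℝ, 0 ≤ α ∧ AvoidanceLimitWith α ∧ fusionExponent α = 2) : AvoidanceLimit := by
  obtain ⟨α, hα, hA, hF⟩ := h
  have h58 : α = 5 / 8 := (fusionExponent_eq_two_iff hα).1 hF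
  rw [h58] at hA
  exact avoidanceLimit_iff_with.2 hA

/-! ## Lever 2: the determinantal (symplectic-fermion, n = −2) anchor -/

/-- The simple-random-walk Green's function of the discrete domain `Ω_δ` between `a` and `b`,
written as the walk sum `Σ_ω 4^{-|ω|}` over ALL nearest-neighbour walks of `Ω_δ` from `a` to `b`
(walks killed on leaving the largest component; `= ((1 − A/4)⁻¹)_{ab}`, finite for bounded `Ω`). -/
def greenFn (Ω : Set ℂ) (δ : ℝ) (a b : Site 2) : ℝ≥0∞ :=
  ∑' ω : (discreteDomainGraph Ω δ).Walk a b, (4 : ℝ≥0∞)⁻¹ ^ ω.length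

/-- **LERWBoundaryRatio — the `n = −2` anchor, typed exactly like the crux and like the route's
`IsingBoundaryRatio`.** For `D' ⊆ D` a hull subdomain (same marked points, agreeing with `D` near
them), an endpoint approximation joined in both, and restriction data `(φ, A, Φ, d)` as in
`AvoidanceLimit`, the ratio of SRW Green's functions `G_{Ω'_δ}(a_δ,b_δ)/G_{Ω_δ}(a_δ,b_δ)` tends to
`d = Φ'_A(0)` (exponent `b(−2) = 1`). By the adjugate path expansion this ratio IS the two-leg
boundary ratio `R_δ(n = −2, t = −1, x = 1/4; D, D')` of the loop(−2)+dimer(−1) dressed SAW.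
Discrete potential theory (Kozdron–Lawler 2005 type Poisson-kernel estimates); provable now, M–L. -/
def LERWBoundaryRatio : Prop :=
  ∀ (D D' : DobrushinDomain) (a b : ℝ → Site 2), SAW.IsEndpointApprox D a b →
    SAW.IsEndpointApprox D' a b →
    D'.carrier ⊆ D.carrier → D'.pt 0 = D.pt 0 → D'.pt 1 = D.pt 1 →
    (∃ ε : ℝ, 0 < ε ∧ D'.carrier ∩ Metric.ball (D.pt 0) ε = D.carrier ∩ Metric.ball (D.pt 0) ε ∧
      D'.carrier ∩ Metric.ball (D.pt 1) ε = D.carrier ∩ Metric.ball (D.pt 1) ε) →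
    ∀ (φ : ConformalEquiv UpperHalfPlane.upperHalfPlaneSet D.carrier), D.IsChordalUniformizing φ →
    ∀ (A : Set ℂ), A = closure (UpperHalfPlane.upperHalfPlaneSet \
      {z | z ∈ UpperHalfPlane.upperHalfPlaneSet ∧ φ z ∈ D'.carrier}) →
    ∀ (Φ : ConformalEquiv (UpperHalfPlane.upperHalfPlaneSet \ A) UpperHalfPlane.upperHalfPlaneSet)
      (d : ℝ), IsRestrictionMap A Φ → HasRestrictionDeriv A Φ d →
    Tendsto (fun δ => greenFn D'.carrier δ (a δ) (b δ) / greenFn D.carrier δ (a δ) (b δ))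
      (𝓝[>] 0) (𝓝 (ENNReal.ofReal d))

/-- **The exact dictionary at the anchor (classical; Lawler's chronological loop-erasure /
Viennot heaps): adjugate path expansion.** For a finite simple graph with adjacency matrix `A`
and a scalar `x`, `adj(1 − xA)_{ab} = Σ_{self-avoiding paths p : a → b} x^{|p|} · det((1 − xA)|_{V ∖ p})`.
Read through the permutation expansion of the minors, the right side is the two-leg function of
the SAW dressed by a gas of mutually- and self-avoiding loops of fugacity `n = −2` and dimers of
fugacity `t = −1` (edge weight `x`): the `n = −2` member of the dilute loop family is determinantal. -/
theorem adjugate_pathExpansion {V : Type*} [Fintype V] [DecidableEq V] (G : SimpleGraph V)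
    [DecidableRel G.Adj] (x : ℝ) (a b : V) :
    ((1 : Matrix V V ℝ) - x • G.adjMatrix ℝ).adjugate a b =
      ∑ n ∈ Finset.range (Fintype.card V),
        ∑ p ∈ (G.finsetWalkLength n a b).filter (fun p => p.IsPath),
          x ^ n * (((1 : Matrix V V ℝ) - x • G.adjMatrix ℝ).submatrix
            (Subtype.val : {v // v ∉ p.support} → V) (Subtype.val : {v // v ∉ p.support} → V)).det := by
  sorry

/-! ## Lever 3: the SAW-corner germ of the fugacity flow -/

open Classical in
/-- The `x_c`-mass of self-avoiding polygons of `Ω_δ` that MEET the walk `γ` (share a vertex):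
`L_hit(γ) = Σ_{P ∩ γ ≠ ∅} x_c^{|P|}` — minus the first `n`-derivative of the two-leg loop-model
weight at `n = 0` (one loop, which the walk forbids). -/
def hitPolygonMass (Ω : Set ℂ) (δ : ℝ) {a b : Site 2} (γ : SAW.DomainSAW Ω δ a b) : ℝ≥0∞ :=
  ∑' E : Finset (Sym2 (Site 2)),
    if SAW.IsPolygon (discreteDomainGraph Ω δ) E ∧ ∃ v ∈ γ.walk.support, ∃ e ∈ E, v ∈ e
    then ENNReal.ofReal (SAW.criticalFugacity ^ E.card) else 0

/-- **CornerGerm (the falsifiable first-order identity of the `n`-continuation at the SAW end).**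
There is ONE constant `ℓ` (the bulk hit-polygon density per step, `= x_c'(0)/x_c`, slope of the
critical line of the ℤ² dilute non-crossing loop model at the SAW point) such that for every hull
subdomain pair and restriction data as in the crux, the difference between `D` and `D'` of the
expected COMPENSATED hit-polygon mass `E[L_hit(γ) − ℓ|γ|]` converges to `b'(0)·log d` with
`b'(0) = −3/(8π)` (`b = 3/κ − 1/2`, `n = −2cos(4π/κ)`, chain rule at `κ = 8/3`). -/
def CornerGerm : Prop :=
  ∃ ℓ : ℝ, ∀ (D D' : DobrushinDomain) (a b : ℝ → Site 2), SAW.IsEndpointApprox D a b →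
    SAW.IsEndpointApprox D' a b →
    D'.carrier ⊆ D.carrier → D'.pt 0 = D.pt 0 → D'.pt 1 = D.pt 1 →
    (∃ ε : ℝ, 0 < ε ∧ D'.carrier ∩ Metric.ball (D.pt 0) ε = D.carrier ∩ Metric.ball (D.pt 0) ε ∧
      D'.carrier ∩ Metric.ball (D.pt 1) ε = D.carrier ∩ Metric.ball (D.pt 1) ε) →
    ∀ (φ : ConformalEquiv UpperHalfPlane.upperHalfPlaneSet D.carrier), D.IsChordalUniformizing φ →
    ∀ (A : Set ℂ), A = closure (UpperHalfPlane.upperHalfPlaneSet \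
      {z | z ∈ UpperHalfPlane.upperHalfPlaneSet ∧ φ z ∈ D'.carrier}) →
    ∀ (Φ : ConformalEquiv (UpperHalfPlane.upperHalfPlaneSet \ A) UpperHalfPlane.upperHalfPlaneSet)
      (d : ℝ), IsRestrictionMap A Φ → HasRestrictionDeriv A Φ d →
    Tendsto (fun δ =>
        (∫ γ, ((hitPolygonMass D.carrier δ γ).toReal - ℓ * γ.length) ∂(SAW.law D.carrier δ (a δ) (b δ)))
      - (∫ γ, ((hitPolygonMass D'.carrier δ γ).toReal - ℓ * γ.length) ∂(SAW.law D'.carrier δ (a δ) (b δ))))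
      (𝓝[>] 0) (𝓝 (-(3 / (8 * Real.pi)) * Real.log d))

/-- The chain-rule value `b'(0) = (db/dκ)/(dn/dκ)` at `κ = 8/3`: with `b(κ) = 3/κ − 1/2` and
`n(κ) = −2cos(4π/κ)`, `db/dκ = −27/64` and `dn/dκ = 9π/8`, so `b'(0) = −3/(8π)`. -/
theorem cornerGerm_slope :
    (-(27 : ℝ) / 64) / (9 * Real.pi / 8) = -(3 / (8 * Real.pi)) := by
  have hπ : Real.pi ≠ 0 := Real.pi_ne_zero
  field_simp
  ring

theorem db_dκ : deriv (fun κ : ℝ => 3 / κ - 1 / 2) (8 / 3) = -(27 : ℝ) / 64 := by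
  have h1 : HasDerivAt (fun κ : ℝ => 3 * κ⁻¹) (3 * (-((8 / 3 : ℝ) ^ 2)⁻¹)) (8 / 3) :=
    (hasDerivAt_inv (by norm_num : (8 / 3 : ℝ) ≠ 0)).const_mul 3
  have h2 : HasDerivAt (fun κ : ℝ => 3 / κ - 1 / 2) (3 * (-((8 / 3 : ℝ) ^ 2)⁻¹)) (8 / 3) := by
    have := h1.sub_const (1 / 2)
    simpa [div_eq_mul_inv] using this
  rw [h2.deriv]; norm_num

theorem dn_dκ : deriv (fun κ : ℝ => -2 * Real.cos (4 * Real.pi / κ)) (8 / 3) = 9 * Real.pi / 8 := by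
  have hκ : (8 / 3 : ℝ) ≠ 0 := by norm_num
  have hin : HasDerivAt (fun κ : ℝ => 4 * Real.pi / κ) (4 * Real.pi * (-((8 / 3 : ℝ) ^ 2)⁻¹)) (8 / 3) := by
    simpa [div_eq_mul_inv] using (hasDerivAt_inv hκ).const_mul (4 * Real.pi)
  have h := (hin.cos).const_mul (-2)
  rw [h.deriv]
  have harg : 4 * Real.pi / (8 / 3 : ℝ) = Real.pi / 2 + Real.pi := by ring
  rw [harg, Real.sin_add_pi, Real.sin_pi_div_two]
  norm_num
  ring

end Summit.CriticalPhenomena.SAWScalingLimit.Cruxes.AvoidanceLimit.Ideator1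

end
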